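import Literature.NumberTheory.Automorphic.UnitaryGroupBorelSemidirect
import Literature.NumberTheory.Automorphic.UnitaryGroupGlobalGenericity
import Literature.NumberTheory.Automorphic.AdicCompletionCompact
import HarnessLib

/-!
# The Heisenberg chart of the unipotent radical `N(𝔸_F)` of the Borel subgroup of `U(3)`, its Haar
# measure in coordinates and the conjugation action of the torus

Topic `NumberTheory/Automorphic`; namespace `Literature.NumberTheory.Automorphic.UnitaryGroup`.
DEFINITIONS with bodies + proved structure lemmas; no named fact, no `sorry`, no instance, no
notation. Setting: the quasi-split unitary group `U_{E/F}(3) = U(J₃)` of Mok / Rogawski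
(`UnitaryGroup.quasiSplit F E c 3`, `J₃ = antidiag(1,1,1)`), `c` an involution (`c * c = 1`), and the
unipotent radical `N(𝔸_F) = adelicUnipotent F E c 3` of its Borel subgroup, viewed inside the group
`B(𝔸_F)` as `unipotentInBorel F E c 3` (`UnitaryGroupBorelSemidirect`).

Rogawski (1990), §1.10: `N = {u(x, z)}`, `u(x, z) = [[1, x, z], [0, 1, x̄'], [0, 0, 1]]` with
`x x̄ + z + z̄ = 0` (for the tree's `J₃` the `(1,2)` entry is `-c(x)` and the relation reads
`z + c(z) + x c(x) = 0`, `apply_rev_rev_eq_neg_conjAdele`, `sum_conjAdele_mul_rev_eq`). We use the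
global chart `(x, y) ∈ 𝔸_E × 𝔸_E⁻`, `z = y − ½ x c(x)` (`𝔸_E⁻ = traceZeroAdele`, the trace-zero adeles):

* `heisElt hc x y ∈ N(𝔸_F)` — the element `u(x, y − ½ x c(x))` (its inverse matrix, unitarity,
  membership are checked by explicit `3 × 3` computations); `heisX u = u₀₁`, `heisY u = u₀₂ + ½ u₀₁ c(u₀₁)
  ∈ 𝔸_E⁻` — the inverse chart; **`heisHomeomorph hc : 𝔸_E × 𝔸_E⁻ ≃ₜ N(𝔸_F)`**.
* the group law in coordinates: `heisX (u v) = heisX u + heisX v`,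
  `heisY (u v) = heisY u + heisY v + ½ (x_v c(x_u) − x_u c(x_v))` — a central extension of `𝔸_E` by
  `𝔸_E⁻`, left translations are SKEW PRODUCTS of translations;
* the torus acts diagonally: for `t = diag(d₀, d₁, d₂) ∈ T(𝔸_F)`,
  `heisX (t⁻¹ u t) = d₀⁻¹ d₁ · heisX u` and `heisY (t⁻¹ u t) = d₀⁻¹ d₂ · heisY u` (`d₀⁻¹ d₂ = (d₀ c(d₀))⁻¹`
  is `c`-fixed, so it preserves `𝔸_E⁻`);
* **`heisHaar`** — the image of `μ_{𝔸_E} ⊗ μ_{𝔸_E⁻}` under the chart **is a Haar measure on `N(𝔸_F)`**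
  (`isHaarMeasure_heisHaar`: left invariant by Mathlib's `MeasurePreserving.skew_product`, finite on
  compacts and positive on opens through the homeomorphism) — Bourbaki, *Intégration* VII §3 no. 3:
  the Haar measure of a nilpotent group is the Lebesgue measure of its coordinates of the second kind.

The companion file `UnitaryGroupBorelModulusThree` feeds this into
`IsTopSemidirect.modularCharacter_eq_of_map_conjBy` (`isTopSemidirect_borelAdelic`) to compute
`δ_B(d(a, b, ā⁻¹)) = ‖a‖_{𝔸_E}²` (Rogawski (1990), §2.2, §3).

## References

* J. D. Rogawski, *Automorphic Representations of Unitary Groups in Three Variables* (1990), §1.10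
  [Rogawski1990].
* N. Bourbaki, *Intégration*, Ch. VII §3 no. 3.
* J. R. Getz, H. Hahn, *An Introduction to Automorphic Representations* (2024), §3.5 [GetzHahn2024].
-/

noncomputable section

open Matrix NumberField IsDedekindDomain Topology MeasureTheory Measure
open scoped MatrixGroups Pointwise

namespace Literature.NumberTheory.Automorphic

namespace UnitaryGroup

variable {F E : Type} [Field F] [NumberField F] [Field E] [NumberField E] [Algebra F E]
  {c : E ≃ₐ[F] E}

/-! ## §1 The element `u(x, y − ½ x c(x))` and the chart -/

/-- `½ ∈ 𝔸_E` (the principal adele of `2⁻¹ ∈ E`; plumbing constant of the Heisenberg chart).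
[folklore] -/
def halfAdele : AdeleRing (𝓞 E) E := algebraMap E (AdeleRing (𝓞 E) E) 2⁻¹

omit [NumberField F] [Algebra F E] in
/-- `½ + ½ = 1` in `𝔸_E`. [folklore] -/
private theorem half_add_half : (halfAdele : AdeleRing (𝓞 E) E) + halfAdele = 1 := by
  rw [halfAdele, ← map_add, ← map_one (algebraMap E (AdeleRing (𝓞 E) E))]
  congr 1
  norm_num

omit [NumberField F] in
/-- `c(½) = ½`. [folklore] -/
private theorem conjAdele_half : conjAdele F E c (halfAdele : AdeleRing (𝓞 E) E) = halfAdele := by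
  rw [halfAdele, ← algebraMap_conj]
  congr 1
  rw [RingHom.coe_coe, map_inv₀, map_ofNat]

/-- The matrix of an adelic point of `U(J₃)`. [folklore] -/
private abbrev mat3 (g : (quasiSplit F E c 3).Adelic) : Matrix (Fin 3) (Fin 3) (AdeleRing (𝓞 E) E) :=
  (adelicVal F E c 3 _ g : Matrix (Fin 3) (Fin 3) (AdeleRing (𝓞 E) E))

/-- The `z`-entry `z = y − ½ x c(x)` of the chart. [cite: Rogawski1990, §1.10] -/
def heisZ (x y : AdeleRing (𝓞 E) E) : AdeleRing (𝓞 E) E := y - halfAdele * (x * conjAdele F E c x)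

omit [NumberField F] in
/-- **The defining relation `z + c(z) + x c(x) = 0`** of `N` holds for `z = y − ½ x c(x)`, `y ∈ 𝔸_E⁻`.
[cite: Rogawski1990, §1.10] -/
theorem heisZ_add_conjAdele (hc : c * c = 1) (x : AdeleRing (𝓞 E) E) {y : AdeleRing (𝓞 E) E}
    (hy : y ∈ traceZeroAdele F E c) :
    heisZ (c := c) x y + conjAdele F E c (heisZ (c := c) x y) = -(x * conjAdele F E c x) := by
  rw [mem_traceZeroAdele_iff] at hy
  simp only [heisZ, map_sub, map_mul, conjAdele_half, conjAdele_conjAdele hc, hy]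
  have h2 := half_add_half (E := E)
  linear_combination (-(x * conjAdele F E c x)) * h2

/-- The matrix `u(x, z) = [[1, x, z], [0, 1, -c(x)], [0, 0, 1]]`, `z = y − ½ x c(x)`.
[cite: Rogawski1990, §1.10] -/
def heisMatrix (x y : AdeleRing (𝓞 E) E) : Matrix (Fin 3) (Fin 3) (AdeleRing (𝓞 E) E) :=
  !![1, x, heisZ (c := c) x y; 0, 1, -conjAdele F E c x; 0, 0, 1]

/-- The inverse matrix `u(x, z)⁻¹ = [[1, -x, c(z)], [0, 1, c(x)], [0, 0, 1]]` (valid when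
`z + c(z) + x c(x) = 0`). [cite: Rogawski1990, §1.10] -/
def heisMatrixInv (x y : AdeleRing (𝓞 E) E) : Matrix (Fin 3) (Fin 3) (AdeleRing (𝓞 E) E) :=
  !![1, -x, conjAdele F E c (heisZ (c := c) x y); 0, 1, conjAdele F E c x; 0, 0, 1]

omit [NumberField F] in
/-- `u(x,z) · u(x,z)⁻¹ = 1`. [cite: Rogawski1990, §1.10] -/
theorem heisMatrix_mul_heisMatrixInv (hc : c * c = 1) (x : AdeleRing (𝓞 E) E) {y : AdeleRing (𝓞 E) E}
    (hy : y ∈ traceZeroAdele F E c) :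
    heisMatrix (c := c) x y * heisMatrixInv (c := c) x y = 1 := by
  have hrel := heisZ_add_conjAdele hc x hy
  ext i j
  fin_cases i <;> fin_cases j <;>
    simp [heisMatrix, heisMatrixInv, Matrix.mul_apply, Fin.sum_univ_three, -conjAdele_apply]
  all_goals linear_combination hrel

omit [NumberField F] in
/-- `u(x,z)⁻¹ · u(x,z) = 1`. [cite: Rogawski1990, §1.10] -/
theorem heisMatrixInv_mul_heisMatrix (hc : c * c = 1) (x : AdeleRing (𝓞 E) E) {y : AdeleRing (𝓞 E) E}
    (hy : y ∈ traceZeroAdele F E c) :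
    heisMatrixInv (c := c) x y * heisMatrix (c := c) x y = 1 := by
  have hrel := heisZ_add_conjAdele hc x hy
  ext i j
  fin_cases i <;> fin_cases j <;>
    simp [heisMatrix, heisMatrixInv, Matrix.mul_apply, Fin.sum_univ_three, -conjAdele_apply]
  all_goals linear_combination hrel

/-- `u(x, z)` as an invertible adelic matrix. [cite: Rogawski1990, §1.10] -/
def heisGL (hc : c * c = 1) (x : AdeleRing (𝓞 E) E) (y : traceZeroAdele F E c) :
    GL (Fin 3) (AdeleRing (𝓞 E) E) :=
  ⟨heisMatrix (c := c) x y, heisMatrixInv (c := c) x y, heisMatrix_mul_heisMatrixInv hc x y.2,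
    heisMatrixInv_mul_heisMatrix hc x y.2⟩

omit [NumberField F] in
/-- The matrix of `heisGL`. [cite: Rogawski1990, §1.10] -/
@[simp] theorem coe_heisGL (hc : c * c = 1) (x : AdeleRing (𝓞 E) E) (y : traceZeroAdele F E c) :
    (heisGL hc x y : Matrix (Fin 3) (Fin 3) (AdeleRing (𝓞 E) E)) = heisMatrix (c := c) x y := rfl

omit [NumberField F] in
/-- **`u(x, z) ∈ U(J₃)(𝔸_F)`**: the unitarity relations `ᵗ(c u) J₃ u = J₃` reduce to `c(c(x)) = x` and
`z + c(z) + x c(x) = 0` (Rogawski (1990), §1.10: `x x̄ + z + z̄ = 0` in his normalisation).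
[cite: Rogawski1990, §1.10] -/
theorem heisGL_mem_adelic (hc : c * c = 1) (x : AdeleRing (𝓞 E) E) (y : traceZeroAdele F E c) :
    heisGL hc x y ∈ adelic F E c 3 ((StdForm.antidiagonal 3).over E) := by
  have hrel := heisZ_add_conjAdele hc x y.2
  have hcc := conjAdele_conjAdele (F := F) (E := E) hc
  change heisGL hc x y ∈ unitaryGroupOfForm (conjAdele F E c) (adelicForm E 3 ((StdForm.antidiagonal 3).over E))
  rw [adelicForm_antidiagonal, mem_unitaryGroupOfForm_antidiagonal_iff_sum']
  have r0 : (0 : Fin 3).rev = 2 := rfl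
  have r1 : (1 : Fin 3).rev = 1 := rfl
  have r2 : (2 : Fin 3).rev = 0 := rfl
  intro a b
  fin_cases a <;> fin_cases b <;>
    simp [heisMatrix, Fin.sum_univ_three, r0, r1, r2, hcc, map_neg, -conjAdele_apply]
  all_goals linear_combination hrel

/-- **The chart**: `heisElt hc x y = u(x, y − ½ x c(x)) ∈ N(𝔸_F)` (as an element of the subgroup
`unipotentInBorel F E c 3` of `B(𝔸_F)`). [cite: Rogawski1990, §1.10] -/
def heisElt (hc : c * c = 1) (x : AdeleRing (𝓞 E) E) (y : traceZeroAdele F E c) :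
    unipotentInBorel F E c 3 :=
  ⟨⟨⟨heisGL hc x y, heisGL_mem_adelic hc x y⟩, by
      intro i j hij
      change (j : Fin 3) < i at hij
      change heisMatrix (c := c) x y i j = 0
      fin_cases i <;> fin_cases j <;> simp [heisMatrix] at hij ⊢⟩,
    by
      rw [mem_unipotentInBorel_iff, mem_adelicUnipotent_iff, mem_upperUnitriangular_iff]
      refine ⟨?_, fun i => ?_⟩
      · intro i j hij
        change (j : Fin 3) < i at hij
        change heisMatrix (c := c) x y i j = 0
        fin_cases i <;> fin_cases j <;> simp [heisMatrix] at hij ⊢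
      · change heisMatrix (c := c) x y i i = 1
        fin_cases i <;> simp [heisMatrix]⟩

/-- Entries of the chart: the matrix of `heisElt hc x y` is `heisMatrix x y`. [cite: Rogawski1990, §1.10] -/
theorem mat_heisElt (hc : c * c = 1) (x : AdeleRing (𝓞 E) E) (y : traceZeroAdele F E c) :
    (adelicVal F E c 3 _ (((heisElt hc x y : unipotentInBorel F E c 3) : borelAdelic F E c 3) :
      (quasiSplit F E c 3).Adelic) : Matrix (Fin 3) (Fin 3) (AdeleRing (𝓞 E) E)) =
      heisMatrix (c := c) x y := rfl

/-! ## §2 The inverse chart `u ↦ (u₀₁, u₀₂ + ½ u₀₁ c(u₀₁))` -/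

/-- The matrix of `u ∈ N(𝔸_F) ≤ B(𝔸_F)`. [folklore] -/
private abbrev umat (u : unipotentInBorel F E c 3) : Matrix (Fin 3) (Fin 3) (AdeleRing (𝓞 E) E) :=
  mat3 (((u : unipotentInBorel F E c 3) : borelAdelic F E c 3) : (quasiSplit F E c 3).Adelic)

/-- `umat (u v) = umat u * umat v`. [folklore] -/
private theorem umat_mul (u v : unipotentInBorel F E c 3) : umat (u * v) = umat u * umat v := by
  simp only [umat, mat3, Subgroup.coe_mul, map_mul, Units.val_mul]

/-- `u ∈ N(𝔸_F)` as an element of the tree's `adelicUnipotent`. [folklore] -/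
private def toUnip (u : unipotentInBorel F E c 3) : adelicUnipotent F E c 3 :=
  ⟨((u : borelAdelic F E c 3) : (quasiSplit F E c 3).Adelic), u.2⟩

/-- Shape of `u ∈ N(𝔸_F)`: unitriangular. [folklore] -/
private theorem umat_shape (u : unipotentInBorel F E c 3) :
    umat u 1 0 = 0 ∧ umat u 2 0 = 0 ∧ umat u 2 1 = 0 ∧ umat u 0 0 = 1 ∧ umat u 1 1 = 1 ∧ umat u 2 2 = 1 := by
  obtain ⟨htri, hdiag⟩ := (mem_upperUnitriangular_iff _).1 ((mem_adelicUnipotent_iff _).1 u.2)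
  exact ⟨htri (show ((0 : Fin 3)) < 1 by decide), htri (show ((0 : Fin 3)) < 2 by decide),
    htri (show ((1 : Fin 3)) < 2 by decide), hdiag 0, hdiag 1, hdiag 2⟩

/-- **`u₁₂ = -c(u₀₁)`** on `N(𝔸_F)` (the pairing of the simple-root coordinates). [cite: Rogawski1990, §1.10] -/
theorem umat_one_two (u : unipotentInBorel F E c 3) :
    (adelicVal F E c 3 _ (((u : unipotentInBorel F E c 3) : borelAdelic F E c 3) :
      (quasiSplit F E c 3).Adelic) : Matrix (Fin 3) (Fin 3) (AdeleRing (𝓞 E) E)) 1 2 =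
      -conjAdele F E c ((adelicVal F E c 3 _ (((u : unipotentInBorel F E c 3) : borelAdelic F E c 3) :
        (quasiSplit F E c 3).Adelic) : Matrix (Fin 3) (Fin 3) (AdeleRing (𝓞 E) E)) 0 1) :=
  apply_rev_rev_eq_neg_conjAdele (toUnip u) (i := 0) (j := 1) rfl

/-- **`u₀₂ + c(u₀₂) + u₀₁ c(u₀₁) = 0`** on `N(𝔸_F)` (the `(2,2)` unitarity relation; Rogawski's
`x x̄ + z + z̄ = 0`). [cite: Rogawski1990, §1.10] -/
theorem umat_zero_two_add_conjAdele (hc : c * c = 1) (u : unipotentInBorel F E c 3) :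
    umat u 0 2 + conjAdele F E c (umat u 0 2) = -(umat u 0 1 * conjAdele F E c (umat u 0 1)) := by
  have key := sum_conjAdele_mul_rev_eq
    (((u : unipotentInBorel F E c 3) : borelAdelic F E c 3) : (quasiSplit F E c 3).Adelic) 2 2
  obtain ⟨-, -, -, -, -, h22⟩ := umat_shape u
  have h12 := umat_one_two u
  have r0 : (0 : Fin 3).rev = 2 := rfl
  have r1 : (1 : Fin 3).rev = 1 := rfl
  have r2 : (2 : Fin 3).rev = 0 := rfl
  simp only [Fin.sum_univ_three, r0, r1, r2, show ((2 : Fin 3) = 0) = False by decide, if_false] at key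
  change conjAdele F E c (umat u 0 2) * umat u 2 2 + conjAdele F E c (umat u 1 2) * umat u 1 2 +
    conjAdele F E c (umat u 2 2) * umat u 0 2 = 0 at key
  change umat u 1 2 = -conjAdele F E c (umat u 0 1) at h12
  rw [h22, h12, map_one, map_neg, conjAdele_conjAdele hc] at key
  linear_combination key

/-- **The first coordinate `x = u₀₁`.** [cite: Rogawski1990, §1.10] -/
def heisX (u : unipotentInBorel F E c 3) : AdeleRing (𝓞 E) E := umat u 0 1

/-- **The second coordinate `y = u₀₂ + ½ u₀₁ c(u₀₁) ∈ 𝔸_E⁻`** (trace zero by the `(2,2)` unitarity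
relation). [cite: Rogawski1990, §1.10] -/
def heisY (hc : c * c = 1) (u : unipotentInBorel F E c 3) : traceZeroAdele F E c :=
  ⟨umat u 0 2 + halfAdele * (umat u 0 1 * conjAdele F E c (umat u 0 1)), by
    rw [mem_traceZeroAdele_iff, map_add, map_mul, conjAdele_half, map_mul, conjAdele_conjAdele hc]
    have h := umat_zero_two_add_conjAdele hc u
    have h2 := half_add_half (E := E)
    linear_combination h + (umat u 0 1 * conjAdele F E c (umat u 0 1)) * h2⟩

/-- `heisX` unfolded. [cite: Rogawski1990, §1.10] -/
theorem heisX_def (u : unipotentInBorel F E c 3) :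
    heisX u = (adelicVal F E c 3 _ (((u : unipotentInBorel F E c 3) : borelAdelic F E c 3) :
      (quasiSplit F E c 3).Adelic) : Matrix (Fin 3) (Fin 3) (AdeleRing (𝓞 E) E)) 0 1 := rfl

/-- `heisY` unfolded. [cite: Rogawski1990, §1.10] -/
theorem coe_heisY (hc : c * c = 1) (u : unipotentInBorel F E c 3) :
    (heisY hc u : AdeleRing (𝓞 E) E) =
      (adelicVal F E c 3 _ (((u : unipotentInBorel F E c 3) : borelAdelic F E c 3) :
        (quasiSplit F E c 3).Adelic) : Matrix (Fin 3) (Fin 3) (AdeleRing (𝓞 E) E)) 0 2 +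
      halfAdele * (heisX u * conjAdele F E c (heisX u)) := rfl

/-- Round trip: `heisX (u(x, y)) = x`. [cite: Rogawski1990, §1.10] -/
@[simp] theorem heisX_heisElt (hc : c * c = 1) (x : AdeleRing (𝓞 E) E) (y : traceZeroAdele F E c) :
    heisX (heisElt hc x y) = x := by
  simp [heisX, umat, mat3, mat_heisElt, heisMatrix]

/-- Round trip: `heisY (u(x, y)) = y`. [cite: Rogawski1990, §1.10] -/
@[simp] theorem heisY_heisElt (hc : c * c = 1) (x : AdeleRing (𝓞 E) E) (y : traceZeroAdele F E c) :
    heisY hc (heisElt hc x y) = y := by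
  refine Subtype.ext ?_
  simp [heisY, umat, mat3, mat_heisElt, heisMatrix, heisZ, -conjAdele_apply]

/-- Round trip: `u(heisX u, heisY u) = u`. [cite: Rogawski1990, §1.10] -/
@[simp] theorem heisElt_heisX_heisY (hc : c * c = 1) (u : unipotentInBorel F E c 3) :
    heisElt hc (heisX u) (heisY hc u) = u := by
  obtain ⟨h10, h20, h21, h00, h11, h22⟩ := umat_shape u
  have h12 := umat_one_two u
  change umat u 1 2 = -conjAdele F E c (umat u 0 1) at h12
  refine Subtype.ext (Subtype.ext (adelicVal_injective F E c 3 _ (Matrix.GeneralLinearGroup.ext fun i j => ?_)))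
  change heisMatrix (c := c) (heisX u) (heisY hc u) i j = umat u i j
  fin_cases i <;> fin_cases j <;>
    simp [heisMatrix, heisX, heisY, heisZ, h10, h20, h21, h00, h11, h22, h12]

/-- The chart is continuous. [cite: Rogawski1990, §1.10] -/
theorem continuous_heisElt (hc : c * c = 1) :
    Continuous fun p : AdeleRing (𝓞 E) E × traceZeroAdele F E c => heisElt hc p.1 p.2 := by
  have hcA := continuous_conjAdele F E c
  have hx : Continuous fun p : AdeleRing (𝓞 E) E × traceZeroAdele F E c => p.1 := continuous_fst
  have hy : Continuous fun p : AdeleRing (𝓞 E) E × traceZeroAdele F E c => (p.2 : AdeleRing (𝓞 E) E) :=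
    continuous_subtype_val.comp continuous_snd
  have hz : Continuous fun p : AdeleRing (𝓞 E) E × traceZeroAdele F E c => heisZ (c := c) p.1 p.2 :=
    hy.sub (continuous_const.mul (hx.mul (hcA.comp hx)))
  have hGL : Continuous fun p : AdeleRing (𝓞 E) E × traceZeroAdele F E c => heisGL hc p.1 p.2 := by
    refine Units.continuous_iff.2 ⟨?_, ?_⟩
    · refine continuous_matrix fun i j => ?_
      fin_cases i <;> fin_cases j <;>
        simp [heisGL, heisMatrix, -conjAdele_apply] <;>
        first | exact continuous_const | exact hx | exact hz | exact (hcA.comp hx).neg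
    · refine continuous_matrix fun i j => ?_
      fin_cases i <;> fin_cases j <;>
        simp [heisGL, heisMatrixInv, -conjAdele_apply] <;>
        first | exact continuous_const | exact hx.neg | exact hcA.comp hz | exact hcA.comp hx
  exact ((hGL.subtype_mk _).subtype_mk _).subtype_mk _

/-- The inverse chart is continuous. [cite: Rogawski1990, §1.10] -/
theorem continuous_heisX : Continuous (heisX (F := F) (E := E) (c := c)) :=
  ((Units.continuous_val.comp (continuous_subtype_val.comp
    (continuous_subtype_val.comp continuous_subtype_val))).matrix_elem 0 1)

/-- The inverse chart is continuous. [cite: Rogawski1990, §1.10] -/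
theorem continuous_heisY (hc : c * c = 1) : Continuous (heisY (F := F) (E := E) hc) := by
  have hm : Continuous fun u : unipotentInBorel F E c 3 => umat u :=
    Units.continuous_val.comp (continuous_subtype_val.comp
      (continuous_subtype_val.comp continuous_subtype_val))
  refine Continuous.subtype_mk ?_ _
  exact (hm.matrix_elem 0 2).add (continuous_const.mul ((hm.matrix_elem 0 1).mul
    ((continuous_conjAdele F E c).comp (hm.matrix_elem 0 1))))

/-- **The Heisenberg chart `𝔸_E × 𝔸_E⁻ ≃ₜ N(𝔸_F)`**, `(x, y) ↦ u(x, y − ½ x c(x))` (Rogawski (1990),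
§1.10: `N = {u(x, z)}`). [cite: Rogawski1990, §1.10] -/
def heisHomeomorph (hc : c * c = 1) :
    AdeleRing (𝓞 E) E × traceZeroAdele F E c ≃ₜ unipotentInBorel F E c 3 where
  toFun p := heisElt hc p.1 p.2
  invFun u := (heisX u, heisY hc u)
  left_inv p := by simp
  right_inv u := heisElt_heisX_heisY hc u
  continuous_toFun := continuous_heisElt hc
  continuous_invFun := continuous_heisX.prodMk (continuous_heisY hc)

/-- `heisHomeomorph hc (x, y) = heisElt hc x y`. [cite: Rogawski1990, §1.10] -/
@[simp] theorem heisHomeomorph_apply (hc : c * c = 1) (p : AdeleRing (𝓞 E) E × traceZeroAdele F E c) :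
    heisHomeomorph hc p = heisElt hc p.1 p.2 := rfl

/-- `(heisHomeomorph hc).symm u = (heisX u, heisY u)`. [cite: Rogawski1990, §1.10] -/
@[simp] theorem heisHomeomorph_symm_apply (hc : c * c = 1) (u : unipotentInBorel F E c 3) :
    (heisHomeomorph hc).symm u = (heisX u, heisY hc u) := rfl

/-! ## §3 The group law in coordinates (a central extension of `𝔸_E` by `𝔸_E⁻`) -/

/-- **`x(u v) = x(u) + x(v)`.** [cite: Rogawski1990, §1.10] -/
theorem heisX_mul (u v : unipotentInBorel F E c 3) : heisX (u * v) = heisX u + heisX v := by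
  obtain ⟨-, -, hv21, hu00, hv11, -⟩ := umat_shape v
  obtain ⟨-, -, -, hu00', -, -⟩ := umat_shape u
  change umat (u * v) 0 1 = umat u 0 1 + umat v 0 1
  rw [umat_mul, Matrix.mul_apply, Fin.sum_univ_three, hu00', hv11, hv21]
  ring

/-- **`y(u v) = y(u) + y(v) + ½ (x(v) c(x(u)) − x(u) c(x(v)))`** — the commutator cocycle of the
Heisenberg group (`z(u v) = z(u) + z(v) − x(u) c(x(v))`). [cite: Rogawski1990, §1.10] -/
theorem coe_heisY_mul (hc : c * c = 1) (u v : unipotentInBorel F E c 3) :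
    (heisY hc (u * v) : AdeleRing (𝓞 E) E) = (heisY hc u : AdeleRing (𝓞 E) E) + (heisY hc v : AdeleRing (𝓞 E) E) +
      halfAdele * (heisX v * conjAdele F E c (heisX u) - heisX u * conjAdele F E c (heisX v)) := by
  obtain ⟨-, -, -, hu00, -, -⟩ := umat_shape u
  obtain ⟨-, -, -, -, -, hv22⟩ := umat_shape v
  have hv12 : umat v 1 2 = -conjAdele F E c (umat v 0 1) := umat_one_two v
  have e1 : (heisY hc (u * v) : AdeleRing (𝓞 E) E) =
      umat (u * v) 0 2 + halfAdele * (umat (u * v) 0 1 * conjAdele F E c (umat (u * v) 0 1)) := rfl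
  have e2 : (heisY hc u : AdeleRing (𝓞 E) E) = umat u 0 2 + halfAdele * (umat u 0 1 * conjAdele F E c (umat u 0 1)) := rfl
  have e3 : (heisY hc v : AdeleRing (𝓞 E) E) = umat v 0 2 + halfAdele * (umat v 0 1 * conjAdele F E c (umat v 0 1)) := rfl
  have ex : heisX u = umat u 0 1 := rfl
  have ey : heisX v = umat v 0 1 := rfl
  have h01 : umat (u * v) 0 1 = umat u 0 1 + umat v 0 1 := heisX_mul u v
  have h02 : umat (u * v) 0 2 = umat v 0 2 + umat u 0 1 * umat v 1 2 + umat u 0 2 := by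
    rw [umat_mul, Matrix.mul_apply, Fin.sum_univ_three, hu00, hv22]; ring
  rw [e1, e2, e3, ex, ey, h01, h02, hv12, map_add]
  have h2 := half_add_half (E := E)
  linear_combination (umat u 0 1 * conjAdele F E c (umat v 0 1)) * h2

/-- **Left translation in coordinates, first coordinate**: `x(u₀ · u(x, y)) = x(u₀) + x`.
[cite: Rogawski1990, §1.10] -/
theorem heisX_mul_heisElt (hc : c * c = 1) (u₀ : unipotentInBorel F E c 3)
    (x : AdeleRing (𝓞 E) E) (y : traceZeroAdele F E c) :
    heisX (u₀ * heisElt hc x y) = heisX u₀ + x := by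
  rw [heisX_mul, heisX_heisElt]

/-- **Left translation in coordinates, second coordinate** (a translation depending on `x` only):
`y(u₀ · u(x, y)) = y + (y(u₀) + ½ (x c(x(u₀)) − x(u₀) c(x)))`. [cite: Rogawski1990, §1.10] -/
theorem coe_heisY_mul_heisElt (hc : c * c = 1) (u₀ : unipotentInBorel F E c 3)
    (x : AdeleRing (𝓞 E) E) (y : traceZeroAdele F E c) :
    (heisY hc (u₀ * heisElt hc x y) : AdeleRing (𝓞 E) E) = (y : AdeleRing (𝓞 E) E) +
      ((heisY hc u₀ : AdeleRing (𝓞 E) E) + halfAdele * (x * conjAdele F E c (heisX u₀) - heisX u₀ * conjAdele F E c x)) := by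
  rw [coe_heisY_mul, heisX_heisElt, heisY_heisElt]
  ring

/-- The translation part `y(u₀) + ½ (x c(x(u₀)) − x(u₀) c(x))` lies in `𝔸_E⁻`. [cite: Rogawski1990, §1.10] -/
theorem heisShift_mem (hc : c * c = 1) (u₀ : unipotentInBorel F E c 3) (x : AdeleRing (𝓞 E) E) :
    (heisY hc u₀ : AdeleRing (𝓞 E) E) + halfAdele * (x * conjAdele F E c (heisX u₀) - heisX u₀ * conjAdele F E c x) ∈
      traceZeroAdele F E c := by
  have h := (heisY hc (u₀ * heisElt hc x (0 : traceZeroAdele F E c))).2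
  rw [coe_heisY_mul_heisElt] at h
  simpa using h

/-! ## §4 The torus acts diagonally on the coordinates -/

/-- Entries of `t⁻¹ u t` for `t = diag(d)`: `(t⁻¹ u t)ᵢⱼ = dᵢ⁻¹ uᵢⱼ dⱼ`. [cite: Rogawski1990, §1.10] -/
theorem umat_conjBy (t : torusInBorel F E c 3) {d : Fin 3 → (AdeleRing (𝓞 E) E)ˣ}
    (hd : glDiagonal 3 (AdeleRing (𝓞 E) E) d =
      adelicVal F E c 3 _ ((t : borelAdelic F E c 3) : (quasiSplit F E c 3).Adelic))
    (u : unipotentInBorel F E c 3) (i j : Fin 3) :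
    (adelicVal F E c 3 _ (((isTopSemidirect_borelAdelic.conjBy t u : unipotentInBorel F E c 3) :
      borelAdelic F E c 3) : (quasiSplit F E c 3).Adelic) : Matrix (Fin 3) (Fin 3) (AdeleRing (𝓞 E) E)) i j =
      ((d i)⁻¹ : (AdeleRing (𝓞 E) E)ˣ) *
        (adelicVal F E c 3 _ (((u : unipotentInBorel F E c 3) : borelAdelic F E c 3) :
          (quasiSplit F E c 3).Adelic) : Matrix (Fin 3) (Fin 3) (AdeleRing (𝓞 E) E)) i j * d j := by
  change (adelicVal F E c 3 _ ((((t : borelAdelic F E c 3) : (quasiSplit F E c 3).Adelic))⁻¹ *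
    (((u : unipotentInBorel F E c 3) : borelAdelic F E c 3) : (quasiSplit F E c 3).Adelic) *
    ((t : borelAdelic F E c 3) : (quasiSplit F E c 3).Adelic)) :
      Matrix (Fin 3) (Fin 3) (AdeleRing (𝓞 E) E)) i j = _
  rw [map_mul, map_mul, map_inv, ← hd, ← map_inv, Units.val_mul, Units.val_mul, coe_glDiagonal,
    coe_glDiagonal, Matrix.mul_diagonal, Matrix.diagonal_mul, Pi.inv_apply]

/-- The torus relations of `T(𝔸_F) ≤ U(J₃)`: `c(d₂) d₀ = 1`, `c(d₁) d₁ = 1`, `c(d₀) d₂ = 1`.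
[cite: Rogawski1990, §1.10] -/
theorem torus_relations (t : torusInBorel F E c 3) {d : Fin 3 → (AdeleRing (𝓞 E) E)ˣ}
    (hd : glDiagonal 3 (AdeleRing (𝓞 E) E) d =
      adelicVal F E c 3 _ ((t : borelAdelic F E c 3) : (quasiSplit F E c 3).Adelic)) :
    conjAdele F E c (d 2 : AdeleRing (𝓞 E) E) * d 0 = 1 ∧
      conjAdele F E c (d 1 : AdeleRing (𝓞 E) E) * d 1 = 1 ∧
      conjAdele F E c (d 0 : AdeleRing (𝓞 E) E) * d 2 = 1 := by
  have h := adelicVal_mem_unitaryGroupOfForm ((t : borelAdelic F E c 3) : (quasiSplit F E c 3).Adelic)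
  rw [← hd] at h
  have hrel := (glDiagonal_mem_unitaryGroupOfForm_antidiagonal_iff _ 3 d).1 h
  exact ⟨hrel 0, hrel 1, hrel 2⟩

/-- **`x(t⁻¹ u t) = d₀⁻¹ d₁ · x(u)`.** [cite: Rogawski1990, §1.10] -/
theorem heisX_conjBy (t : torusInBorel F E c 3) {d : Fin 3 → (AdeleRing (𝓞 E) E)ˣ}
    (hd : glDiagonal 3 (AdeleRing (𝓞 E) E) d =
      adelicVal F E c 3 _ ((t : borelAdelic F E c 3) : (quasiSplit F E c 3).Adelic))
    (u : unipotentInBorel F E c 3) :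
    heisX (isTopSemidirect_borelAdelic.conjBy t u) = (((d 0)⁻¹ * d 1 : (AdeleRing (𝓞 E) E)ˣ) : AdeleRing (𝓞 E) E) * heisX u := by
  rw [heisX_def, umat_conjBy t hd u 0 1, heisX_def, Units.val_mul]
  ring

/-- **`y(t⁻¹ u t) = d₀⁻¹ d₂ · y(u)`** (using the torus relations: `d₀⁻¹ d₁ · c(d₀⁻¹ d₁) = d₀⁻¹ d₂`).
[cite: Rogawski1990, §1.10] -/
theorem coe_heisY_conjBy (hc : c * c = 1) (t : torusInBorel F E c 3) {d : Fin 3 → (AdeleRing (𝓞 E) E)ˣ}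
    (hd : glDiagonal 3 (AdeleRing (𝓞 E) E) d =
      adelicVal F E c 3 _ ((t : borelAdelic F E c 3) : (quasiSplit F E c 3).Adelic))
    (u : unipotentInBorel F E c 3) :
    (heisY hc (isTopSemidirect_borelAdelic.conjBy t u) : AdeleRing (𝓞 E) E) =
      (((d 0)⁻¹ * d 2 : (AdeleRing (𝓞 E) E)ˣ) : AdeleRing (𝓞 E) E) * heisY hc u := by
  obtain ⟨h20, h11, h02⟩ := torus_relations t hd
  -- `c(d₁) = d₁⁻¹`, `c(d₀⁻¹) = d₂` as adeles
  have hc1 : conjAdele F E c (d 1 : AdeleRing (𝓞 E) E) = ((d 1)⁻¹ : (AdeleRing (𝓞 E) E)ˣ) :=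
    (Units.inv_eq_of_mul_eq_one_left h11).symm
  have hc0 : conjAdele F E c (((d 0)⁻¹ : (AdeleRing (𝓞 E) E)ˣ) : AdeleRing (𝓞 E) E) = d 2 := by
    have h1 : conjAdele F E c (((d 0)⁻¹ : (AdeleRing (𝓞 E) E)ˣ) : AdeleRing (𝓞 E) E) *
        conjAdele F E c (d 0 : AdeleRing (𝓞 E) E) = 1 := by
      rw [← map_mul, Units.inv_mul, map_one]
    have h2 : conjAdele F E c (d 0 : AdeleRing (𝓞 E) E) = ((d 2)⁻¹ : (AdeleRing (𝓞 E) E)ˣ) :=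
      (Units.inv_eq_of_mul_eq_one_left h02).symm
    rw [h2] at h1
    calc conjAdele F E c (((d 0)⁻¹ : (AdeleRing (𝓞 E) E)ˣ) : AdeleRing (𝓞 E) E)
        = conjAdele F E c (((d 0)⁻¹ : (AdeleRing (𝓞 E) E)ˣ) : AdeleRing (𝓞 E) E) *
            (((d 2)⁻¹ : (AdeleRing (𝓞 E) E)ˣ) : AdeleRing (𝓞 E) E) * d 2 := by
          rw [mul_assoc, Units.inv_mul, mul_one]
      _ = d 2 := by rw [h1, one_mul]
  rw [coe_heisY, coe_heisY, heisX_conjBy t hd u, umat_conjBy t hd u 0 2, Units.val_mul, Units.val_mul,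
    map_mul, map_mul, hc0, hc1]
  -- the unit identity `d₀⁻¹ d₁ · (d₂ d₁⁻¹) = d₀⁻¹ d₂`
  have hkey : (((d 0)⁻¹ : (AdeleRing (𝓞 E) E)ˣ) : AdeleRing (𝓞 E) E) * d 1 *
      ((d 2 : AdeleRing (𝓞 E) E) * (((d 1)⁻¹ : (AdeleRing (𝓞 E) E)ˣ) : AdeleRing (𝓞 E) E)) =
      (((d 0)⁻¹ : (AdeleRing (𝓞 E) E)ˣ) : AdeleRing (𝓞 E) E) * d 2 := by
    rw [mul_comm (d 2 : AdeleRing (𝓞 E) E), ← mul_assoc, mul_assoc (((d 0)⁻¹ : (AdeleRing (𝓞 E) E)ˣ) :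
      AdeleRing (𝓞 E) E), Units.mul_inv, mul_one]
  linear_combination (halfAdele * heisX u * conjAdele F E c (heisX u)) * hkey

/-- `d₀⁻¹ d₂` is `c`-fixed on `T(𝔸_F)` (`= (d₀ c(d₀))⁻¹`). [cite: Rogawski1990, §1.10] -/
theorem conjAdele_torusCentralScalar (t : torusInBorel F E c 3) {d : Fin 3 → (AdeleRing (𝓞 E) E)ˣ}
    (hd : glDiagonal 3 (AdeleRing (𝓞 E) E) d =
      adelicVal F E c 3 _ ((t : borelAdelic F E c 3) : (quasiSplit F E c 3).Adelic)) :
    conjAdele F E c ((((d 0)⁻¹ * d 2 : (AdeleRing (𝓞 E) E)ˣ)) : AdeleRing (𝓞 E) E) = (((d 0)⁻¹ * d 2 : (AdeleRing (𝓞 E) E)ˣ) : _) := by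
  obtain ⟨h20, -, h02⟩ := torus_relations t hd
  -- `c(d₂) = d₀⁻¹` and `c(d₀⁻¹) = d₂`
  have hc2 : conjAdele F E c (d 2 : AdeleRing (𝓞 E) E) = ((d 0)⁻¹ : (AdeleRing (𝓞 E) E)ˣ) :=
    (Units.inv_eq_of_mul_eq_one_left h20).symm
  have hc0 : conjAdele F E c (((d 0)⁻¹ : (AdeleRing (𝓞 E) E)ˣ) : AdeleRing (𝓞 E) E) = d 2 := by
    have h1 : conjAdele F E c (((d 0)⁻¹ : (AdeleRing (𝓞 E) E)ˣ) : AdeleRing (𝓞 E) E) *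
        conjAdele F E c (d 0 : AdeleRing (𝓞 E) E) = 1 := by
      rw [← map_mul, Units.inv_mul, map_one]
    have h2 : conjAdele F E c (d 0 : AdeleRing (𝓞 E) E) = ((d 2)⁻¹ : (AdeleRing (𝓞 E) E)ˣ) :=
      (Units.inv_eq_of_mul_eq_one_left h02).symm
    rw [h2] at h1
    calc conjAdele F E c (((d 0)⁻¹ : (AdeleRing (𝓞 E) E)ˣ) : AdeleRing (𝓞 E) E)
        = conjAdele F E c (((d 0)⁻¹ : (AdeleRing (𝓞 E) E)ˣ) : AdeleRing (𝓞 E) E) *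
            (((d 2)⁻¹ : (AdeleRing (𝓞 E) E)ˣ) : AdeleRing (𝓞 E) E) * d 2 := by
          rw [mul_assoc, Units.inv_mul, mul_one]
      _ = d 2 := by rw [h1, one_mul]
  rw [Units.val_mul, map_mul, hc0, hc2, mul_comm]

end UnitaryGroup

end Literature.NumberTheory.Automorphic
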